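import Summits.CriticalPhenomena.PercolationContinuityZ3.Theorems.PercNearOneGluingNoHeavyLowerTailKnQuestion8CoefficientwiseQmixRootEdgeMain
import Summits.CriticalPhenomena.PercolationContinuityZ3.Theorems.PercNearOneGluingNoHeavyLowerTailKnQuestion8CoefficientwiseNoCoreDegTwo
import HarnessLib

/-!
# The two-point exclusion at a point with a ROOT EDGE, part 4: NO-CORE at the degree-two vertex of the residue shape — prim-lf-2 gen 51 (part 4 of 4)

Support file (`--supports stmt-CriticalPhenomena-4575`, closed), prover `prim-lf-2` (gen 51).  No definitions, no named facts, no sorries; standard axioms.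
Memo `prim-lf-2/CW-ROOTEDGE-gen51.md` §3; parts 1–3: `…CoefficientwiseQmixRootEdgeClasses.lean`, `…QmixRootEdgeWall.lean`, `…QmixRootEdgeMain.lean`.

Setting.  Finite multigraph `ends : ι → Sym2 V`, root `x`, `K(s) = openCluster (ends '' s) x`.  The 6-vertex residue of CONJECTURE NO-CORE for the point functions after prim-lf-2
gen 50 (CW-TWOSOURCE-gen50 §1.3: 108 `(G, y)`, 13 isomorphism types) consists of vertices `y` of degree two, `N(y) = {p, q}`, with both points `u, w` adjacent to the root; in the
types without the edge `pq` one point, say `u`, has `N(u) = {p, q, x}` and `{x, w}` separates `p` from `q` in `G − y − u`.  Gen 48's degree-two reduction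
(`noCore_degTwo_nonneg_of_qmix`: NO-CORE(y) = tied Harris + `Q_mix^{G−y}(p,q)` + `Q_mix^{G−y}(q,p)`) and part 3's `qmix_rootEdge_pointIndicator_nonneg_of_sep` /
`qmix_rootEdge_nonneg_of_sep` on the sub-multigraph `G − y` (edge type `{j // j ≠ j₁ ∧ j ≠ j₂}`, where `u` keeps its three edges) give:
* `noCore_rootEdge_nonneg_of_sep` — `0 ≤ NO-CORE(y)[1_u, g]` for every monotone `g` ignoring `y`, when `x` separates `p` from `q` in `G − y − u`;
* `noCore_rootEdge_nonneg_of_adj_root` — `0 ≤ NO-CORE(y)[1_u, g]` for every monotone `g` ignoring `y` when `p ∼ x` and `q ∼ x` (both wall sums empty);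
* `noCore_rootEdge_pointIndicator_nonneg_of_sep` — `0 ≤ NO-CORE(y)[1_u, 1_w] = Σ_{s : ¬(y ∈ K s ∧ y ∈ K sᶜ)} ([u∈K s] − [u∈K sᶜ])([w∈K s] − [w∈K sᶜ])` when `{x, w}` separates
  `p` from `q` in `G − y − u` (every residual 6-vertex `(G,y)` of gen 50 without the edge `pq`: 33 of 108, prim-lf-2 code/gen51/nccov51.c; the 75 with the edge `pq` are
  CONJECTURE ROOT-DOM instances on 4 vertices, part 3's `qmix_rootEdge_nonneg_of_wallClasses`).
The separation hypotheses are stated on the red sets of the whole multigraph that avoid the five edges `yp, yq, up, uq, ux` (`image_subMultigraph_eq` moves them to `G − y`).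
[cite: KozmaNitzan2024, Questions 8–9 (§5.5 p. 36) (context: the Question-8 pocket covariance programme)]
-/

namespace Summit.CriticalPhenomena.PercolationContinuityZ3.Theorems

open Finset Literature.Probability.Percolation

namespace Coefficientwise

variable {ι V : Type*} [Fintype ι] [DecidableEq ι] (ends : ι → Sym2 V) (x : V)

section noCoreResidue

variable {y u p q : V} {j₁ j₂ i_p i_q i_x : ι}

omit [Fintype ι] [DecidableEq ι] in
/-- The red edge set of a sub-cube colouring, read in the whole multigraph. [cite: KozmaNitzan2024, §5.5 (context only; bookkeeping)] -/
theorem image_subMultigraph_eq (P : ι → Prop) (t : Finset {j : ι // P j}) :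
    (fun j : {j : ι // P j} => ends j.1) '' (↑t : Set {j : ι // P j}) = ends '' (↑(t.map (Function.Embedding.subtype P)) : Set ι) := by
  ext e
  constructor
  · rintro ⟨j, hj, rfl⟩
    refine ⟨j.1, ?_, rfl⟩
    rw [Finset.mem_coe, Finset.mem_map]
    exact ⟨j, hj, rfl⟩
  · rintro ⟨i, hi, rfl⟩
    rw [Finset.mem_coe, Finset.mem_map] at hi
    obtain ⟨j, hj, rfl⟩ := hi
    exact ⟨j, hj, rfl⟩

open Classical in
/-- **COROLLARY: NO-CORE at a degree-two `y` whose neighbours `p, q` are the non-root neighbours of a degree-three point `u ∼ x`, when `x` separates `p` from `q` in `G − y − u`.**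
Let `y ∉ {x,p,q,u}` have exactly the edges `j₁ = yp`, `j₂ = yq`, let `u` have exactly the edges `i_p = up`, `i_q = uq`, `i_x = ux`, and suppose every red set avoiding these five edges
that joins `q` to `p` joins `q` to `x`.  Then `0 ≤ NO-CORE(y)[1_u, g] = Σ_{s : ¬(y ∈ K s ∧ y ∈ K sᶜ)} ([u ∈ K s] − [u ∈ K sᶜ])·(g(K s) − g(K sᶜ))` for every monotone `g` ignoring `y`
(gen 48's degree-two reduction + `qmix_rootEdge_nonneg_of_sep` on `G − y` in both orientations).  [cite: KozmaNitzan2024, Questions 8–9 (§5.5 p. 36) (context)] -/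
theorem noCore_rootEdge_nonneg_of_sep (hj₁ : ends j₁ = s(y, p)) (hj₂ : ends j₂ = s(y, q)) (hjne : j₁ ≠ j₂)
    (hdegy : ∀ i, y ∈ ends i → i = j₁ ∨ i = j₂)
    (hi_p : ends i_p = s(u, p)) (hi_q : ends i_q = s(u, q)) (hi_x : ends i_x = s(u, x))
    (hpq : i_p ≠ i_q) (hpx : i_p ≠ i_x) (hqx : i_q ≠ i_x)
    (hdegu : ∀ i, u ∈ ends i → i = i_p ∨ i = i_q ∨ i = i_x)
    (hpy : p ≠ y) (hqy : q ≠ y) (hxy : x ≠ y) (hpu : p ≠ u) (hqu : q ≠ u) (hxu : x ≠ u) (hyu : y ≠ u)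
    (hsep : ∀ s : Finset ι, j₁ ∉ s → j₂ ∉ s → i_p ∉ s → i_q ∉ s → i_x ∉ s →
      p ∈ openCluster (ends '' (↑s : Set ι)) q → x ∈ openCluster (ends '' (↑s : Set ι)) q)
    (g : Set V → ℝ) (hg : Monotone g) (hgy : ∀ C : Set V, g (insert y C) = g C) :
    0 ≤ ∑ s ∈ univ.filter (fun s : Finset ι =>
        ¬ (y ∈ openCluster (ends '' (↑s : Set ι)) x ∧ y ∈ openCluster (ends '' (↑(sᶜ) : Set ι)) x)),
      ((if u ∈ openCluster (ends '' (↑s : Set ι)) x then (1 : ℝ) else 0) - (if u ∈ openCluster (ends '' (↑(sᶜ) : Set ι)) x then (1 : ℝ) else 0)) *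
        (g (openCluster (ends '' (↑s : Set ι)) x) - g (openCluster (ends '' (↑(sᶜ) : Set ι)) x)) := by
  -- the edges of `u` avoid `y`, so they survive in `G − y`
  have havoid : ∀ {i : ι} {v : V}, ends i = s(u, v) → v ≠ y → i ≠ j₁ ∧ i ≠ j₂ := by
    intro i v hi hvy
    have hyi : y ∉ ends i := by
      rw [hi, Sym2.mem_iff]; rintro (h | h); exact hyu h; exact hvy h.symm
    constructor
    · rintro rfl; apply hyi; rw [hj₁]; exact Sym2.mem_mk_left _ _
    · rintro rfl; apply hyi; rw [hj₂]; exact Sym2.mem_mk_left _ _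
  have hi_pne := havoid hi_p hpy
  have hi_qne := havoid hi_q hqy
  have hi_xne := havoid hi_x hxy
  set ends' : {j : ι // j ≠ j₁ ∧ j ≠ j₂} → Sym2 V := fun j => ends j.1 with hends'
  have hi_p' : ends' ⟨i_p, hi_pne⟩ = s(u, p) := hi_p
  have hi_q' : ends' ⟨i_q, hi_qne⟩ = s(u, q) := hi_q
  have hi_x' : ends' ⟨i_x, hi_xne⟩ = s(u, x) := hi_x
  have hpq' : (⟨i_p, hi_pne⟩ : {j : ι // j ≠ j₁ ∧ j ≠ j₂}) ≠ ⟨i_q, hi_qne⟩ := fun h => hpq (congrArg Subtype.val h)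
  have hpx' : (⟨i_p, hi_pne⟩ : {j : ι // j ≠ j₁ ∧ j ≠ j₂}) ≠ ⟨i_x, hi_xne⟩ := fun h => hpx (congrArg Subtype.val h)
  have hqx' : (⟨i_q, hi_qne⟩ : {j : ι // j ≠ j₁ ∧ j ≠ j₂}) ≠ ⟨i_x, hi_xne⟩ := fun h => hqx (congrArg Subtype.val h)
  have hdegu' : ∀ i : {j : ι // j ≠ j₁ ∧ j ≠ j₂}, u ∈ ends' i → i = ⟨i_p, hi_pne⟩ ∨ i = ⟨i_q, hi_qne⟩ ∨ i = ⟨i_x, hi_xne⟩ := by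
    intro i hi
    rcases hdegu i.1 hi with h | h | h
    · exact Or.inl (Subtype.ext h)
    · exact Or.inr (Or.inl (Subtype.ext h))
    · exact Or.inr (Or.inr (Subtype.ext h))
  have hdegu'' : ∀ i : {j : ι // j ≠ j₁ ∧ j ≠ j₂}, u ∈ ends' i → i = ⟨i_q, hi_qne⟩ ∨ i = ⟨i_p, hi_pne⟩ ∨ i = ⟨i_x, hi_xne⟩ := by
    intro i hi
    rcases hdegu' i hi with h | h | h
    · exact Or.inr (Or.inl h)
    · exact Or.inl h
    · exact Or.inr (Or.inr h)
  -- the separation hypothesis, read in `G − y`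
  have hsep' : ∀ (a b : V), (∀ s : Finset ι, j₁ ∉ s → j₂ ∉ s → i_p ∉ s → i_q ∉ s → i_x ∉ s →
        a ∈ openCluster (ends '' (↑s : Set ι)) b → x ∈ openCluster (ends '' (↑s : Set ι)) b) →
      ∀ t : Finset {j : ι // j ≠ j₁ ∧ j ≠ j₂}, (⟨i_p, hi_pne⟩ : {j : ι // j ≠ j₁ ∧ j ≠ j₂}) ∉ t → (⟨i_q, hi_qne⟩ : {j : ι // j ≠ j₁ ∧ j ≠ j₂}) ∉ t →
        (⟨i_x, hi_xne⟩ : {j : ι // j ≠ j₁ ∧ j ≠ j₂}) ∉ t →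
        a ∈ openCluster (ends' '' (↑t : Set {j : ι // j ≠ j₁ ∧ j ≠ j₂})) b → x ∈ openCluster (ends' '' (↑t : Set {j : ι // j ≠ j₁ ∧ j ≠ j₂})) b := by
    intro a b h t h1 h2 h3 hab
    rw [hends', image_subMultigraph_eq ends (fun j : ι => j ≠ j₁ ∧ j ≠ j₂) t] at hab ⊢
    have hmem : ∀ i, i ∈ t.map (Function.Embedding.subtype _) ↔ ∃ h : i ≠ j₁ ∧ i ≠ j₂, (⟨i, h⟩ : {j : ι // j ≠ j₁ ∧ j ≠ j₂}) ∈ t :=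
      fun i => mem_map_subtype_iff (fun j : ι => j ≠ j₁ ∧ j ≠ j₂) t i
    refine h _ ?_ ?_ ?_ ?_ ?_ hab
    · intro hm; obtain ⟨hh, _⟩ := (hmem j₁).mp hm; exact hh.1 rfl
    · intro hm; obtain ⟨hh, _⟩ := (hmem j₂).mp hm; exact hh.2 rfl
    · intro hm; obtain ⟨hh, ht⟩ := (hmem i_p).mp hm; exact h1 ht
    · intro hm; obtain ⟨hh, ht⟩ := (hmem i_q).mp hm; exact h2 ht
    · intro hm; obtain ⟨hh, ht⟩ := (hmem i_x).mp hm; exact h3 ht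
  have hsep_qp : ∀ s : Finset ι, j₁ ∉ s → j₂ ∉ s → i_p ∉ s → i_q ∉ s → i_x ∉ s →
      q ∈ openCluster (ends '' (↑s : Set ι)) p → x ∈ openCluster (ends '' (↑s : Set ι)) p := by
    intro s h1 h2 h3 h4 h5 hqp
    have hpq'' : p ∈ openCluster (ends '' (↑s : Set ι)) q := SimpleGraph.Reachable.symm hqp
    exact SimpleGraph.Reachable.trans hqp (hsep s h1 h2 h3 h4 h5 hpq'')
  have hfm : Monotone (fun C : Set V => if u ∈ C then (1 : ℝ) else 0) := fun A B hAB => by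
    by_cases hA : u ∈ A
    · simp [hA, hAB hA]
    · simp only [hA, if_false]; split_ifs <;> norm_num
  have hfy : ∀ C : Set V, (fun C : Set V => if u ∈ C then (1 : ℝ) else 0) (insert y C) = (fun C : Set V => if u ∈ C then (1 : ℝ) else 0) C :=
    fun C => by simp [Set.mem_insert_iff, hyu.symm]
  have hQpq := qmix_rootEdge_nonneg_of_sep ends' x hi_p' hi_q' hi_x' hpq' hpx' hqx' hdegu' hpu hqu hxu (hsep' p q hsep) g hg
  have hQqp := qmix_rootEdge_nonneg_of_sep ends' x hi_q' hi_p' hi_x' hpq'.symm hqx' hpx' hdegu'' hqu hpu hxu (fun t h1 h2 h3 => hsep' q p hsep_qp t h2 h1 h3) g hg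
  exact noCore_degTwo_nonneg_of_qmix ends x (fun C : Set V => if u ∈ C then (1 : ℝ) else 0) g hj₁ hj₂ hjne hdegy hpy hqy hxy hfm hg hfy hgy
    hQpq hQqp

open Classical in
/-- **COROLLARY (the 6-vertex residue shape of CONJECTURE NO-CORE for the points, separated case): NO-CORE(y)[1_u, 1_w] ≥ 0.**  Let `y ∉ {x,p,q,u,w}` have exactly the edges
`j₁ = yp`, `j₂ = yq`, let `u ∉ {x,p,q,w}` have exactly the edges `i_p = up`, `i_q = uq`, `i_x = ux`, and suppose every red set avoiding these five edges that joins `q` to `p` joins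
`q` to `x` or to `w` (`{x, w}` separates `p` from `q` in `G − y − u`).  Then
`0 ≤ Σ_{s : ¬(y ∈ K s ∧ y ∈ K sᶜ)} ([u ∈ K s] − [u ∈ K sᶜ])·([w ∈ K s] − [w ∈ K sᶜ])` on every finite multigraph.  (At 6 vertices: every residual `(G, y)` of gen 50 without the
edge `pq`.)  [cite: KozmaNitzan2024, Questions 8–9 (§5.5 p. 36) (context)] -/
theorem noCore_rootEdge_pointIndicator_nonneg_of_sep (hj₁ : ends j₁ = s(y, p)) (hj₂ : ends j₂ = s(y, q)) (hjne : j₁ ≠ j₂)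
    (hdegy : ∀ i, y ∈ ends i → i = j₁ ∨ i = j₂)
    (hi_p : ends i_p = s(u, p)) (hi_q : ends i_q = s(u, q)) (hi_x : ends i_x = s(u, x))
    (hpq : i_p ≠ i_q) (hpx : i_p ≠ i_x) (hqx : i_q ≠ i_x)
    (hdegu : ∀ i, u ∈ ends i → i = i_p ∨ i = i_q ∨ i = i_x)
    (hpy : p ≠ y) (hqy : q ≠ y) (hxy : x ≠ y) (hpu : p ≠ u) (hqu : q ≠ u) (hxu : x ≠ u) (hyu : y ≠ u) {w : V} (hwu : w ≠ u) (hwy : w ≠ y)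
    (hsep : ∀ s : Finset ι, j₁ ∉ s → j₂ ∉ s → i_p ∉ s → i_q ∉ s → i_x ∉ s →
      p ∈ openCluster (ends '' (↑s : Set ι)) q → x ∈ openCluster (ends '' (↑s : Set ι)) q ∨ w ∈ openCluster (ends '' (↑s : Set ι)) q) :
    0 ≤ ∑ s ∈ univ.filter (fun s : Finset ι =>
        ¬ (y ∈ openCluster (ends '' (↑s : Set ι)) x ∧ y ∈ openCluster (ends '' (↑(sᶜ) : Set ι)) x)),
      ((if u ∈ openCluster (ends '' (↑s : Set ι)) x then (1 : ℝ) else 0) - (if u ∈ openCluster (ends '' (↑(sᶜ) : Set ι)) x then (1 : ℝ) else 0)) *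
        ((if w ∈ openCluster (ends '' (↑s : Set ι)) x then (1 : ℝ) else 0) - (if w ∈ openCluster (ends '' (↑(sᶜ) : Set ι)) x then (1 : ℝ) else 0)) := by
  have havoid : ∀ {i : ι} {v : V}, ends i = s(u, v) → v ≠ y → i ≠ j₁ ∧ i ≠ j₂ := by
    intro i v hi hvy
    have hyi : y ∉ ends i := by
      rw [hi, Sym2.mem_iff]; rintro (h | h); exact hyu h; exact hvy h.symm
    constructor
    · rintro rfl; apply hyi; rw [hj₁]; exact Sym2.mem_mk_left _ _
    · rintro rfl; apply hyi; rw [hj₂]; exact Sym2.mem_mk_left _ _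
  have hi_pne := havoid hi_p hpy
  have hi_qne := havoid hi_q hqy
  have hi_xne := havoid hi_x hxy
  set ends' : {j : ι // j ≠ j₁ ∧ j ≠ j₂} → Sym2 V := fun j => ends j.1 with hends'
  have hi_p' : ends' ⟨i_p, hi_pne⟩ = s(u, p) := hi_p
  have hi_q' : ends' ⟨i_q, hi_qne⟩ = s(u, q) := hi_q
  have hi_x' : ends' ⟨i_x, hi_xne⟩ = s(u, x) := hi_x
  have hpq' : (⟨i_p, hi_pne⟩ : {j : ι // j ≠ j₁ ∧ j ≠ j₂}) ≠ ⟨i_q, hi_qne⟩ := fun h => hpq (congrArg Subtype.val h)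
  have hpx' : (⟨i_p, hi_pne⟩ : {j : ι // j ≠ j₁ ∧ j ≠ j₂}) ≠ ⟨i_x, hi_xne⟩ := fun h => hpx (congrArg Subtype.val h)
  have hqx' : (⟨i_q, hi_qne⟩ : {j : ι // j ≠ j₁ ∧ j ≠ j₂}) ≠ ⟨i_x, hi_xne⟩ := fun h => hqx (congrArg Subtype.val h)
  have hdegu' : ∀ i : {j : ι // j ≠ j₁ ∧ j ≠ j₂}, u ∈ ends' i → i = ⟨i_p, hi_pne⟩ ∨ i = ⟨i_q, hi_qne⟩ ∨ i = ⟨i_x, hi_xne⟩ := by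
    intro i hi
    rcases hdegu i.1 hi with h | h | h
    · exact Or.inl (Subtype.ext h)
    · exact Or.inr (Or.inl (Subtype.ext h))
    · exact Or.inr (Or.inr (Subtype.ext h))
  have hdegu'' : ∀ i : {j : ι // j ≠ j₁ ∧ j ≠ j₂}, u ∈ ends' i → i = ⟨i_q, hi_qne⟩ ∨ i = ⟨i_p, hi_pne⟩ ∨ i = ⟨i_x, hi_xne⟩ := by
    intro i hi
    rcases hdegu' i hi with h | h | h
    · exact Or.inr (Or.inl h)
    · exact Or.inl h
    · exact Or.inr (Or.inr h)
  have hsep' : ∀ (a b : V), (∀ s : Finset ι, j₁ ∉ s → j₂ ∉ s → i_p ∉ s → i_q ∉ s → i_x ∉ s →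
        a ∈ openCluster (ends '' (↑s : Set ι)) b → x ∈ openCluster (ends '' (↑s : Set ι)) b ∨ w ∈ openCluster (ends '' (↑s : Set ι)) b) →
      ∀ t : Finset {j : ι // j ≠ j₁ ∧ j ≠ j₂}, (⟨i_p, hi_pne⟩ : {j : ι // j ≠ j₁ ∧ j ≠ j₂}) ∉ t → (⟨i_q, hi_qne⟩ : {j : ι // j ≠ j₁ ∧ j ≠ j₂}) ∉ t →
        (⟨i_x, hi_xne⟩ : {j : ι // j ≠ j₁ ∧ j ≠ j₂}) ∉ t →
        a ∈ openCluster (ends' '' (↑t : Set {j : ι // j ≠ j₁ ∧ j ≠ j₂})) b →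
          x ∈ openCluster (ends' '' (↑t : Set {j : ι // j ≠ j₁ ∧ j ≠ j₂})) b ∨ w ∈ openCluster (ends' '' (↑t : Set {j : ι // j ≠ j₁ ∧ j ≠ j₂})) b := by
    intro a b h t h1 h2 h3 hab
    rw [hends', image_subMultigraph_eq ends (fun j : ι => j ≠ j₁ ∧ j ≠ j₂) t] at hab ⊢
    have hmem : ∀ i, i ∈ t.map (Function.Embedding.subtype _) ↔ ∃ h : i ≠ j₁ ∧ i ≠ j₂, (⟨i, h⟩ : {j : ι // j ≠ j₁ ∧ j ≠ j₂}) ∈ t :=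
      fun i => mem_map_subtype_iff (fun j : ι => j ≠ j₁ ∧ j ≠ j₂) t i
    refine h _ ?_ ?_ ?_ ?_ ?_ hab
    · intro hm; obtain ⟨hh, _⟩ := (hmem j₁).mp hm; exact hh.1 rfl
    · intro hm; obtain ⟨hh, _⟩ := (hmem j₂).mp hm; exact hh.2 rfl
    · intro hm; obtain ⟨hh, ht⟩ := (hmem i_p).mp hm; exact h1 ht
    · intro hm; obtain ⟨hh, ht⟩ := (hmem i_q).mp hm; exact h2 ht
    · intro hm; obtain ⟨hh, ht⟩ := (hmem i_x).mp hm; exact h3 ht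
  have hsep_qp : ∀ s : Finset ι, j₁ ∉ s → j₂ ∉ s → i_p ∉ s → i_q ∉ s → i_x ∉ s →
      q ∈ openCluster (ends '' (↑s : Set ι)) p → x ∈ openCluster (ends '' (↑s : Set ι)) p ∨ w ∈ openCluster (ends '' (↑s : Set ι)) p := by
    intro s h1 h2 h3 h4 h5 hqp
    have hpq'' : p ∈ openCluster (ends '' (↑s : Set ι)) q := SimpleGraph.Reachable.symm hqp
    rcases hsep s h1 h2 h3 h4 h5 hpq'' with hx | hw
    · exact Or.inl (SimpleGraph.Reachable.trans hqp hx)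
    · exact Or.inr (SimpleGraph.Reachable.trans hqp hw)
  have hfm : Monotone (fun C : Set V => if u ∈ C then (1 : ℝ) else 0) := fun A B hAB => by
    by_cases hA : u ∈ A
    · simp [hA, hAB hA]
    · simp only [hA, if_false]; split_ifs <;> norm_num
  have hgm : Monotone (fun C : Set V => if w ∈ C then (1 : ℝ) else 0) := fun A B hAB => by
    by_cases hA : w ∈ A
    · simp [hA, hAB hA]
    · simp only [hA, if_false]; split_ifs <;> norm_num
  have hfy : ∀ C : Set V, (fun C : Set V => if u ∈ C then (1 : ℝ) else 0) (insert y C) = (fun C : Set V => if u ∈ C then (1 : ℝ) else 0) C :=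
    fun C => by simp [Set.mem_insert_iff, hyu.symm]
  have hgy : ∀ C : Set V, (fun C : Set V => if w ∈ C then (1 : ℝ) else 0) (insert y C) = (fun C : Set V => if w ∈ C then (1 : ℝ) else 0) C :=
    fun C => by simp [Set.mem_insert_iff, hwy]
  have hQpq := qmix_rootEdge_pointIndicator_nonneg_of_sep ends' x hi_p' hi_q' hi_x' hpq' hpx' hqx' hdegu' hpu hqu hxu hwu (hsep' p q hsep)
  have hQqp := qmix_rootEdge_pointIndicator_nonneg_of_sep ends' x hi_q' hi_p' hi_x' hpq'.symm hqx' hpx' hdegu'' hqu hpu hxu hwu (fun t h1 h2 h3 => hsep' q p hsep_qp t h2 h1 h3)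
  exact noCore_degTwo_nonneg_of_qmix ends x (fun C : Set V => if u ∈ C then (1 : ℝ) else 0) (fun C : Set V => if w ∈ C then (1 : ℝ) else 0)
    hj₁ hj₂ hjne hdegy hpy hqy hxy hfm hgm hfy hgy hQpq hQqp

open Classical in
/-- **COROLLARY: NO-CORE at the degree-two `y` when `u`'s other neighbours `p, q` are both adjacent to the root.**  Let `y ∉ {x,p,q,u}` have exactly the edges `j₁ = yp`, `j₂ = yq`, let
`u ∉ {x,p,q}` have exactly the edges `i_p = up`, `i_q = uq`, `i_x = ux`, and let `G` contain edges `k_p = px`, `k_q = qx`.  Then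
`0 ≤ NO-CORE(y)[1_u, g] = Σ_{s : ¬(y ∈ K s ∧ y ∈ K sᶜ)} ([u ∈ K s] − [u ∈ K sᶜ])·(g(K s) − g(K sᶜ))` for every monotone `g` ignoring `y` (both ROOT-DOM wall sums are empty).
[cite: KozmaNitzan2024, Questions 8–9 (§5.5 p. 36) (context)] -/
theorem noCore_rootEdge_nonneg_of_adj_root (hj₁ : ends j₁ = s(y, p)) (hj₂ : ends j₂ = s(y, q)) (hjne : j₁ ≠ j₂)
    (hdegy : ∀ i, y ∈ ends i → i = j₁ ∨ i = j₂)
    (hi_p : ends i_p = s(u, p)) (hi_q : ends i_q = s(u, q)) (hi_x : ends i_x = s(u, x))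
    (hpq : i_p ≠ i_q) (hpx : i_p ≠ i_x) (hqx : i_q ≠ i_x)
    (hdegu : ∀ i, u ∈ ends i → i = i_p ∨ i = i_q ∨ i = i_x)
    (hpy : p ≠ y) (hqy : q ≠ y) (hxy : x ≠ y) (hpu : p ≠ u) (hqu : q ≠ u) (hxu : x ≠ u) (hyu : y ≠ u) (hxp : x ≠ p) (hxq : x ≠ q)
    {k_p k_q : ι} (hk_p : ends k_p = s(p, x)) (hk_q : ends k_q = s(q, x))
    (g : Set V → ℝ) (hg : Monotone g) (hgy : ∀ C : Set V, g (insert y C) = g C) :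
    0 ≤ ∑ s ∈ univ.filter (fun s : Finset ι =>
        ¬ (y ∈ openCluster (ends '' (↑s : Set ι)) x ∧ y ∈ openCluster (ends '' (↑(sᶜ) : Set ι)) x)),
      ((if u ∈ openCluster (ends '' (↑s : Set ι)) x then (1 : ℝ) else 0) - (if u ∈ openCluster (ends '' (↑(sᶜ) : Set ι)) x then (1 : ℝ) else 0)) *
        (g (openCluster (ends '' (↑s : Set ι)) x) - g (openCluster (ends '' (↑(sᶜ) : Set ι)) x)) := by
  have havoid : ∀ {i : ι} {a b : V}, ends i = s(a, b) → a ≠ y → b ≠ y → i ≠ j₁ ∧ i ≠ j₂ := by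
    intro i a b hi hay hby
    have hyi : y ∉ ends i := by
      rw [hi, Sym2.mem_iff]; rintro (h | h); exact hay h.symm; exact hby h.symm
    constructor
    · rintro rfl; apply hyi; rw [hj₁]; exact Sym2.mem_mk_left _ _
    · rintro rfl; apply hyi; rw [hj₂]; exact Sym2.mem_mk_left _ _
  have hi_pne := havoid hi_p hyu.symm hpy
  have hi_qne := havoid hi_q hyu.symm hqy
  have hi_xne := havoid hi_x hyu.symm hxy
  have hk_pne := havoid hk_p hpy hxy
  have hk_qne := havoid hk_q hqy hxy
  set ends' : {j : ι // j ≠ j₁ ∧ j ≠ j₂} → Sym2 V := fun j => ends j.1 with hends'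
  have hi_p' : ends' ⟨i_p, hi_pne⟩ = s(u, p) := hi_p
  have hi_q' : ends' ⟨i_q, hi_qne⟩ = s(u, q) := hi_q
  have hi_x' : ends' ⟨i_x, hi_xne⟩ = s(u, x) := hi_x
  have hk_p' : ends' ⟨k_p, hk_pne⟩ = s(p, x) := hk_p
  have hk_q' : ends' ⟨k_q, hk_qne⟩ = s(q, x) := hk_q
  have hpq' : (⟨i_p, hi_pne⟩ : {j : ι // j ≠ j₁ ∧ j ≠ j₂}) ≠ ⟨i_q, hi_qne⟩ := fun h => hpq (congrArg Subtype.val h)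
  have hpx' : (⟨i_p, hi_pne⟩ : {j : ι // j ≠ j₁ ∧ j ≠ j₂}) ≠ ⟨i_x, hi_xne⟩ := fun h => hpx (congrArg Subtype.val h)
  have hqx' : (⟨i_q, hi_qne⟩ : {j : ι // j ≠ j₁ ∧ j ≠ j₂}) ≠ ⟨i_x, hi_xne⟩ := fun h => hqx (congrArg Subtype.val h)
  have hdegu' : ∀ i : {j : ι // j ≠ j₁ ∧ j ≠ j₂}, u ∈ ends' i → i = ⟨i_p, hi_pne⟩ ∨ i = ⟨i_q, hi_qne⟩ ∨ i = ⟨i_x, hi_xne⟩ := by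
    intro i hi
    rcases hdegu i.1 hi with h | h | h
    · exact Or.inl (Subtype.ext h)
    · exact Or.inr (Or.inl (Subtype.ext h))
    · exact Or.inr (Or.inr (Subtype.ext h))
  have hdegu'' : ∀ i : {j : ι // j ≠ j₁ ∧ j ≠ j₂}, u ∈ ends' i → i = ⟨i_q, hi_qne⟩ ∨ i = ⟨i_p, hi_pne⟩ ∨ i = ⟨i_x, hi_xne⟩ := by
    intro i hi
    rcases hdegu' i hi with h | h | h
    · exact Or.inr (Or.inl h)
    · exact Or.inl h
    · exact Or.inr (Or.inr h)
  have hfm : Monotone (fun C : Set V => if u ∈ C then (1 : ℝ) else 0) := fun A B hAB => by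
    by_cases hA : u ∈ A
    · simp [hA, hAB hA]
    · simp only [hA, if_false]; split_ifs <;> norm_num
  have hfy : ∀ C : Set V, (fun C : Set V => if u ∈ C then (1 : ℝ) else 0) (insert y C) = (fun C : Set V => if u ∈ C then (1 : ℝ) else 0) C :=
    fun C => by simp [Set.mem_insert_iff, hyu.symm]
  have hQpq := qmix_rootEdge_nonneg_of_adj_root ends' x hi_p' hi_q' hi_x' hpq' hpx' hqx' hdegu' hpu hqu hxu hxp hxq hk_p' hk_q' g hg
  have hQqp := qmix_rootEdge_nonneg_of_adj_root ends' x hi_q' hi_p' hi_x' hpq'.symm hqx' hpx' hdegu'' hqu hpu hxu hxq hxp hk_q' hk_p' g hg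
  exact noCore_degTwo_nonneg_of_qmix ends x (fun C : Set V => if u ∈ C then (1 : ℝ) else 0) g hj₁ hj₂ hjne hdegy hpy hqy hxy hfm hg hfy hgy
    hQpq hQqp

end noCoreResidue

end Coefficientwise

end Summit.CriticalPhenomena.PercolationContinuityZ3.Theorems
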